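import Literature.MathematicalPhysics.QuantumLattice.BdGPairBlock
import Literature.MathematicalPhysics.QuantumLattice.TorusShellCountUniform
import Literature.MathematicalPhysics.QuantumLattice.PairedProductStates
import Literature.MathematicalPhysics.QuantumLattice.DWaveOrderParameterProofs
import HarnessLib

/-!
# The free Fermi gas has no `d`-wave order: `dWaveOrderParameter 0 μ = 0`

Family `hubbard` / trunk T-QLATTICE. We PROVE that the Koma–Tasaki `d_{x²-y²}` order parameter of
`DWaveSource.lean` vanishes for the FREE (`U = 0`) Hubbard model on the square lattice, at every chemical
potential `μ` (`dWaveOrderParameter_zero_coupling_eq_zero`). Ingredients, all finite-volume and proved: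

* the **Fermi-sea upper bound** `E₀(H(1,0) - μN) ≤ 2 Σ_{k ∈ F} (ε_L(k) - μ)` of
  `PairedProductStates.lean` (fully paired product vectors `Π_{k∈F} b†_k|0⟩` as trial states), at
  `F = {ξ_k < 0}`: `E₀(dWaveSourceTorus L 0 μ 0) ≤ Σ_k (ξ_k - |ξ_k|)`;
* the sourced free Hamiltonian regrouped over time-reversed pair blocks,
  `dWaveSourceTorus L 0 μ s = Σ_k [ξ_k(n_{k↑} + n_{-k↓}) - a_k(b_k + b_k†)]`, `a_k = -2√2 s ĝ_d(k)`
  (`dWaveSourceTorus_zero_eq_sum_pairBlock`; `pairField_dWave_eq_smul_pairOperator` of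
  `PatchPairOperator.lean`, `hubbardTorusWith_zero_eq_sum_momentumNumber`, `torusBand_neg`), and the
  **BdG lower bound** `Σ_k (ξ_k - √(ξ_k² + a_k²)) ≤ E₀(dWaveSourceTorus L 0 μ s)`
  (`sum_bdgLevel_le_groundEnergy_dWaveSourceTorus_zero`; each block is `≥ ξ_k - √(ξ_k²+a_k²)` by the
  sum-of-squares identity of `BdGPairBlock.lean`);
* the elementary gain estimates `√(ξ²+a²) - |ξ| ≤ min(|a|, a²/(2|ξ|))` and the uniform shell count
  `#{k : |ξ_k| ≤ η} ≤ √η L² + 2L` (`TorusShellCountUniform.lean`), giving the **finite-volume energy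
  gain bound** `E₀(H_L(0)) - E₀(H_L(s)) ≤ 4√2|s|(√η L² + 2L) + (4√2 s)²/(2η) L²` for every `η > 0`
  (`groundEnergy_gain_dWaveSourceTorus_zero_le`), i.e. `O(|s|^{5/4}) L²` with `η = √|s|`: the free gas
  responds SUB-LINEARLY to the pair source;
* `dWaveOrderParameter_eq_zero_of_sublinear_gain` (`DWaveOrderParameterProofs.lean`) then gives
  `dWaveOrderParameter 0 μ = 0`.

Context: the weak-coupling route `HubbardSuperconductivity/WeakCouplingBCS` asserts
`e^{-C/U²} ≤ dWaveOrderParameter U μ(U)` for `0 < U < U₀` (crux `WcbcsBcsConstruction`); this file is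
the `U = 0` anchor of that statement (its window cannot be closed at `U = 0`; the positive order
parameter is a LINEAR energy response which the free gas lacks), requested by the crux's standing
disprover. The positive-temperature twin (the exact BdG partition function and the `(1 + log β)s²`
pressure gain) is `DWaveSourceFreePressure.lean` / `DWaveSourceFreeGainBound.lean`.

Sources: J. Bardeen, L. N. Cooper, J. R. Schrieffer, Phys. Rev. 108 (1957) 1175, §II–III;
P. G. de Gennes (1966) Ch. 5; J. von Delft, D. C. Ralph, Phys. Rep. 345 (2001) §4.2.3 (hard-core boson
algebra); T. Koma, H. Tasaki, J. Stat. Phys. 76 (1994) §1 (order parameter). Folklore finite-dimensional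
statements; no named facts, no definitions (the product vector is a local notation).
-/

noncomputable section

namespace Literature.MathematicalPhysics.QuantumLattice

open Matrix Finset Real Filter Literature.Probability.LatticeModels
open scoped ComplexOrder ComplexConjugate
open _root_.Topology


/-! ### Assembly: the sourced free Fermi gas gains only `o(h)·L²`; `dWaveOrderParameter 0 μ = 0` -/

section FreeGasAnchor

variable {L : ℕ} [NeZero L]

/-- A positive-semidefinite lower bound is a ground-energy lower bound: `A - c·1 ≥ 0 ⇒ c ≤ E₀(A)`
(evaluate in the tracial ground state of `A`). [folklore] -/
theorem le_groundEnergy_of_posSemidef_sub {n : Type*} [Fintype n] [DecidableEq n] [Nonempty n]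
    {A : Matrix n n ℂ} (hA : A.IsHermitian) {c : ℝ} (h : (A - (c : ℂ) • (1 : Matrix n n ℂ)).PosSemidef) :
    c ≤ A.groundEnergy := by
  have h0 := Matrix.groundStateFunctional_nonneg_of_posSemidef A h
  rw [map_sub, LinearMap.map_smul_of_tower, Matrix.groundStateFunctional_hamiltonian hA,
    Matrix.groundStateFunctional_one hA] at h0
  obtain ⟨hre, -⟩ := Complex.nonneg_iff.mp h0
  simp only [Complex.sub_re, Complex.ofReal_re, smul_eq_mul, mul_one] at hre
  linarith

omit [NeZero L] in
/-- `|ĝ_d(k)| ≤ 2` (private copy of `abs_dWaveGap_le_two` of `DWaveSourceFreeGainBound.lean`, not imported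
here). [folklore] -/
private theorem abs_dWaveGap_le_two_aux (k : TorusSite 2 L) : |dWaveGap k| ≤ 2 := by
  unfold dWaveGap
  have h1 := Real.abs_cos_le_one (latticeMomentum L k 0)
  have h2 := Real.abs_cos_le_one (latticeMomentum L k 1)
  calc |Real.cos (latticeMomentum L k 0) - Real.cos (latticeMomentum L k 1)|
      ≤ |Real.cos (latticeMomentum L k 0)| + |Real.cos (latticeMomentum L k 1)| := abs_sub _ _
    _ ≤ 2 := by linarith

/-- **`H_L(s)` regrouped over time-reversed pair blocks** (`L ≥ 3`):
`dWaveSourceTorus L 0 μ s = Σ_k [ξ_k (n_{k↑} + n_{-k↓}) - a_k (b_k + b_k†)]` with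
`a_k = -2√2 s ĝ_d(k)`. [folklore] -/
theorem dWaveSourceTorus_zero_eq_sum_pairBlock (hL : 3 ≤ L) (μ s : ℝ) :
    dWaveSourceTorus L 0 μ s = ∑ k : TorusSite 2 L,
      (((torusBand L k - μ : ℝ) : ℂ) • (momentumNumber k 0 + momentumNumber (-k) 1) -
        ((-(2 * Real.sqrt 2 * s * dWaveGap k) : ℝ) : ℂ) • (pairMode k + (pairMode k)ᴴ)) := by
  rw [dWaveSourceTorus, hubbardTorusWith_zero_eq_sum_pairBlock_kinetic hL μ]
  have hsrc : pairField dWaveFormFactor L + (pairField dWaveFormFactor L)ᴴ =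
      -(((2 * Real.sqrt 2 : ℝ) : ℂ) • ∑ k : TorusSite 2 L, (dWaveGap k : ℂ) • (pairMode k + (pairMode k)ᴴ)) := by
    rw [pairField_dWave_eq_smul_pairOperator, conjTranspose_neg, conjTranspose_smul, pairOperator_conjTranspose,
      pairOperator]
    have hstar : star ((2 * Real.sqrt 2 : ℝ) : ℂ) = ((2 * Real.sqrt 2 : ℝ) : ℂ) := Complex.conj_ofReal _
    rw [hstar, ← neg_add, ← smul_add, ← Finset.sum_add_distrib]
    congr 2
    refine Finset.sum_congr rfl fun k _ => ?_
    rw [smul_add, pairMode_conjTranspose]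
  have hcoef : ∀ k : TorusSite 2 L, (s : ℂ) * ((2 * Real.sqrt 2 : ℝ) : ℂ) * (dWaveGap k : ℂ) =
      -(((-(2 * Real.sqrt 2 * s * dWaveGap k)) : ℝ) : ℂ) := by
    intro k
    push_cast
    ring
  rw [hsrc, smul_neg, sub_neg_eq_add, Finset.smul_sum, Finset.smul_sum, ← Finset.sum_add_distrib]
  refine Finset.sum_congr rfl fun k _ => ?_
  rw [smul_smul, smul_smul, hcoef, neg_smul, ← sub_eq_add_neg]

/-- **BdG lower bound for the sourced free gas** (`L ≥ 3`):
`Σ_k (ξ_k - √(ξ_k² + 8s²ĝ_d(k)²)) ≤ E₀(dWaveSourceTorus L 0 μ s)`. [folklore] -/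
theorem sum_bdgLevel_le_groundEnergy_dWaveSourceTorus_zero (hL : 3 ≤ L) (μ s : ℝ) :
    ∑ k : TorusSite 2 L, ((torusBand L k - μ) -
        Real.sqrt ((torusBand L k - μ) ^ 2 + (-(2 * Real.sqrt 2 * s * dWaveGap k)) ^ 2)) ≤
      (dWaveSourceTorus L 0 μ s).groundEnergy := by
  have hH : (dWaveSourceTorus L 0 μ s).IsHermitian :=
    dWaveSourceTorus_isHermitian L (isHermitian_hubbardTorusWith L 1 0 μ) s
  refine le_groundEnergy_of_posSemidef_sub hH ?_
  rw [dWaveSourceTorus_zero_eq_sum_pairBlock hL μ s, Complex.ofReal_sum, Finset.sum_smul,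
    ← Finset.sum_sub_distrib]
  refine Matrix.posSemidef_sum _ fun k _ => ?_
  exact pairMode_block_posSemidef k (torusBand L k - μ) (-(2 * Real.sqrt 2 * s * dWaveGap k))

/-- **Fermi-sea upper bound at zero source** (`L ≥ 3`):
`E₀(dWaveSourceTorus L 0 μ 0) ≤ Σ_k (ξ_k - |ξ_k|)`. [folklore] -/
theorem groundEnergy_dWaveSourceTorus_zero_zero_le (hL : 3 ≤ L) (μ : ℝ) :
    (dWaveSourceTorus L 0 μ 0).groundEnergy ≤
      ∑ k : TorusSite 2 L, ((torusBand L k - μ) - |torusBand L k - μ|) := by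
  classical
  rw [dWaveSourceTorus_zero]
  have h := groundEnergy_hubbardTorusWith_zero_le_two_mul_sum hL μ
    (Finset.univ.filter fun k : TorusSite 2 L => torusBand L k - μ < 0)
  refine h.trans (le_of_eq ?_)
  rw [Finset.mul_sum, Finset.sum_filter]
  refine Finset.sum_congr rfl fun k _ => ?_
  split_ifs with hk
  · rw [abs_of_neg hk]; ring
  · rw [abs_of_nonneg (le_of_not_gt hk)]; ring

/-- Pointwise BdG gain: `√(ξ² + a²) - |ξ| ≤ |a|` (also proved ad hoc as
`Summit.….Theorems.WcbcsLegendre.sqrt_sq_add_sq_sub_abs_le` in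
`Summits/…/Theorems/WeakCouplingBCSWcbcsLegendreCeilingCooperLog.lean`; this is the library home, the
Summits copy can be re-pointed here). [folklore] -/
theorem sqrt_sq_add_sq_sub_abs_le_abs (ξ a : ℝ) : Real.sqrt (ξ ^ 2 + a ^ 2) - |ξ| ≤ |a| := by
  have h : Real.sqrt (ξ ^ 2 + a ^ 2) ≤ |ξ| + |a| := by
    rw [Real.sqrt_le_left (by positivity)]
    nlinarith [abs_nonneg ξ, abs_nonneg a, sq_abs ξ, sq_abs a]
  linarith

/-- Pointwise BdG gain away from the level: `√(ξ² + a²) - |ξ| ≤ a²/(2|ξ|)` for `ξ ≠ 0`. [folklore] -/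
theorem sqrt_sq_add_sq_sub_abs_le_div {ξ : ℝ} (hξ : ξ ≠ 0) (a : ℝ) :
    Real.sqrt (ξ ^ 2 + a ^ 2) - |ξ| ≤ a ^ 2 / (2 * |ξ|) := by
  have hpos : 0 < |ξ| := abs_pos.2 hξ
  have hs : 0 ≤ Real.sqrt (ξ ^ 2 + a ^ 2) := Real.sqrt_nonneg _
  have hsq : Real.sqrt (ξ ^ 2 + a ^ 2) * Real.sqrt (ξ ^ 2 + a ^ 2) = ξ ^ 2 + a ^ 2 :=
    Real.mul_self_sqrt (by positivity)
  rw [le_div_iff₀ (by positivity)]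
  -- `(√(ξ²+a²) - |ξ|)·2|ξ| ≤ (√ - |ξ|)(√ + |ξ|) = a²`
  have hge : |ξ| ≤ Real.sqrt (ξ ^ 2 + a ^ 2) := by
    rw [← Real.sqrt_sq_eq_abs]; exact Real.sqrt_le_sqrt (by nlinarith [sq_nonneg a])
  nlinarith [sq_abs ξ, hsq, hge]

/-- **The sourced free Fermi gas gains only `o(s)·L²` energy from the pair source** (finite `L ≥ 3`,
every `μ`, every `s` and every shell width `η > 0`):
`E₀(H_L(0)) - E₀(H_L(s)) ≤ 4√2|s|·(√η L² + 2L) + (4√2 s)²/(2η)·L²` — BdG lower bound, Fermi-sea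
upper bound, `|√(ξ²+a²) - |ξ|| ≤ min(|a|, a²/(2|ξ|))` with `|a_k| ≤ 4√2|s|`, and the uniform shell
count `#{|ξ_k| ≤ η} ≤ √η L² + 2L` (`card_torusShell_le_sqrt`). [folklore] -/
theorem groundEnergy_gain_dWaveSourceTorus_zero_le (hL : 3 ≤ L) (μ s : ℝ) {η : ℝ} (hη : 0 < η) :
    (dWaveSourceTorus L 0 μ 0).groundEnergy - (dWaveSourceTorus L 0 μ s).groundEnergy ≤
      4 * Real.sqrt 2 * |s| * (Real.sqrt η * (L : ℝ) ^ 2 + 2 * L) +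
        (4 * Real.sqrt 2 * |s|) ^ 2 / (2 * η) * (L : ℝ) ^ 2 := by
  classical
  have hup := groundEnergy_dWaveSourceTorus_zero_zero_le hL μ
  have hlo := sum_bdgLevel_le_groundEnergy_dWaveSourceTorus_zero hL μ s
  set A : ℝ := 4 * Real.sqrt 2 * |s| with hA
  have hA0 : 0 ≤ A := by positivity
  -- pointwise bound on the gain of mode `k`
  have hpt : ∀ k : TorusSite 2 L,
      Real.sqrt ((torusBand L k - μ) ^ 2 + (-(2 * Real.sqrt 2 * s * dWaveGap k)) ^ 2) - |torusBand L k - μ| ≤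
        (if |torusBand L k - μ| ≤ η then A else 0) + A ^ 2 / (2 * η) := by
    intro k
    set ξ := torusBand L k - μ
    set a := -(2 * Real.sqrt 2 * s * dWaveGap k)
    have ha : |a| ≤ A := by
      have hg := abs_dWaveGap_le_two_aux k
      have : |a| = 2 * Real.sqrt 2 * |s| * |dWaveGap k| := by
        simp only [a, abs_neg, abs_mul, abs_of_pos (Real.sqrt_pos.2 (by norm_num : (0:ℝ) < 2))]
        norm_num
      rw [this, hA]
      nlinarith [abs_nonneg s, Real.sqrt_nonneg 2, abs_nonneg (dWaveGap k),
        mul_nonneg (mul_nonneg (by norm_num : (0:ℝ) ≤ 2) (Real.sqrt_nonneg 2)) (abs_nonneg s)]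
    have hdiv : A ^ 2 / (2 * η) ≥ 0 := by positivity
    by_cases hk : |ξ| ≤ η
    · rw [if_pos hk]
      have := sqrt_sq_add_sq_sub_abs_le_abs ξ a
      linarith
    · rw [if_neg hk, zero_add]
      push Not at hk
      have hξ : ξ ≠ 0 := fun h => by rw [h, abs_zero] at hk; linarith
      have h1 := sqrt_sq_add_sq_sub_abs_le_div hξ a
      have h2 : a ^ 2 / (2 * |ξ|) ≤ A ^ 2 / (2 * η) := by
        have ha2 : a ^ 2 ≤ A ^ 2 := by
          rw [← sq_abs a]; exact pow_le_pow_left₀ (abs_nonneg a) ha 2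
        calc a ^ 2 / (2 * |ξ|) ≤ A ^ 2 / (2 * |ξ|) := by gcongr
          _ ≤ A ^ 2 / (2 * η) := by
              apply div_le_div_of_nonneg_left (by positivity) (by positivity)
              linarith
      linarith
  -- sum the pointwise bounds
  have hsum : ∑ k : TorusSite 2 L,
      (Real.sqrt ((torusBand L k - μ) ^ 2 + (-(2 * Real.sqrt 2 * s * dWaveGap k)) ^ 2) - |torusBand L k - μ|) ≤
      A * ((Finset.univ.filter fun k : TorusSite 2 L => |torusBand L k - μ| ≤ η).card : ℝ) +
        A ^ 2 / (2 * η) * (L : ℝ) ^ 2 := by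
    calc _ ≤ ∑ k : TorusSite 2 L, ((if |torusBand L k - μ| ≤ η then A else 0) + A ^ 2 / (2 * η)) :=
          Finset.sum_le_sum fun k _ => hpt k
      _ = _ := by
          rw [Finset.sum_add_distrib, Finset.sum_const, Finset.card_univ, Finset.sum_ite, Finset.sum_const_zero,
            add_zero, Finset.sum_const, nsmul_eq_mul, nsmul_eq_mul, card_torusSite_two L]
          push_cast
          ring
  have hshell := card_torusShell_le_sqrt (L := L) μ η
  have hgain : (dWaveSourceTorus L 0 μ 0).groundEnergy - (dWaveSourceTorus L 0 μ s).groundEnergy ≤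
      ∑ k : TorusSite 2 L, (Real.sqrt ((torusBand L k - μ) ^ 2 + (-(2 * Real.sqrt 2 * s * dWaveGap k)) ^ 2) -
        |torusBand L k - μ|) := by
    have : ∑ k : TorusSite 2 L, ((torusBand L k - μ) - |torusBand L k - μ|) -
        ∑ k : TorusSite 2 L, ((torusBand L k - μ) -
          Real.sqrt ((torusBand L k - μ) ^ 2 + (-(2 * Real.sqrt 2 * s * dWaveGap k)) ^ 2)) =
        ∑ k : TorusSite 2 L, (Real.sqrt ((torusBand L k - μ) ^ 2 + (-(2 * Real.sqrt 2 * s * dWaveGap k)) ^ 2) -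
          |torusBand L k - μ|) := by
      rw [← Finset.sum_sub_distrib]; refine Finset.sum_congr rfl fun k _ => ?_; ring
    linarith
  calc _ ≤ _ := hgain
    _ ≤ A * ((Finset.univ.filter fun k : TorusSite 2 L => |torusBand L k - μ| ≤ η).card : ℝ) +
          A ^ 2 / (2 * η) * (L : ℝ) ^ 2 := hsum
    _ ≤ A * (Real.sqrt η * (L : ℝ) ^ 2 + 2 * L) + A ^ 2 / (2 * η) * (L : ℝ) ^ 2 := by
          gcongr

end FreeGasAnchor

section Final

/-- **The free Fermi gas has no `d`-wave order** (Koma–Tasaki order parameter of `DWaveSource.lean`):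
`dWaveOrderParameter 0 μ = 0` for EVERY chemical potential `μ`. The sourced free torus gains only
`O(s^{5/4}) L²` ground-state energy from a pair source `s` (`groundEnergy_gain_dWaveSourceTorus_zero_le`
with shell width `η = √s`), a sub-linear response, which kills the order parameter
(`dWaveOrderParameter_eq_zero_of_sublinear_gain`). In particular the `U`-window of any weak-coupling
lower bound `e^{-C/U²} ≤ dWaveOrderParameter U μ` cannot be closed at `U = 0`. [folklore] -/
theorem dWaveOrderParameter_zero_coupling_eq_zero (μ : ℝ) : dWaveOrderParameter 0 μ = 0 := by
  set g : ℝ → ℝ := fun h => 8 * Real.sqrt 2 * Real.sqrt (Real.sqrt (2 * h)) + 16 * Real.sqrt (2 * h) with hg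
  set Φ : ℝ → ℝ := fun h => 2 * h * g h with hΦ
  refine dWaveOrderParameter_eq_zero_of_sublinear_gain 0 μ Φ ?_ ?_
  · have hcont : Continuous g := by
      rw [hg]
      fun_prop
    have h0 : g 0 = 0 := by simp [hg]
    have hlim : Tendsto g (𝓝[>] (0 : ℝ)) (𝓝 0) := by
      have := hcont.tendsto 0
      rw [h0] at this
      exact tendsto_nhdsWithin_of_tendsto_nhds this
    refine hlim.congr' ?_
    filter_upwards [self_mem_nhdsWithin] with h hh
    have hh' : (h : ℝ) ≠ 0 := ne_of_gt hh
    simp only [hΦ]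
    field_simp
  · filter_upwards [Ioo_mem_nhdsGT (by norm_num : (0 : ℝ) < 1 / 2)] with h hh
    set s : ℝ := 2 * h with hs
    have hs0 : 0 < s := by rw [hs]; linarith [hh.1]
    set t : ℝ := Real.sqrt (Real.sqrt s) with ht
    have ht0 : 0 < t := Real.sqrt_pos.2 (Real.sqrt_pos.2 hs0)
    have ht2 : t ^ 2 = Real.sqrt s := by rw [ht, Real.sq_sqrt (Real.sqrt_nonneg s)]
    have ht4 : t ^ 4 = s := by
      calc t ^ 4 = (t ^ 2) ^ 2 := by ring
        _ = s := by rw [ht2, Real.sq_sqrt hs0.le]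
    have hev1 : ∀ᶠ L : ℕ in atTop, 3 ≤ L + 1 := by
      filter_upwards [eventually_ge_atTop 2] with L hL; omega
    have hev2 : ∀ᶠ L : ℕ in atTop, 2 ≤ t * (((L + 1 : ℕ) : ℝ)) := by
      have htend : Tendsto (fun L : ℕ => t * (((L + 1 : ℕ) : ℝ))) atTop atTop := by
        refine Tendsto.const_mul_atTop ht0 ?_
        exact tendsto_natCast_atTop_atTop.comp (tendsto_add_atTop_nat 1)
      exact htend.eventually_ge_atTop 2
    filter_upwards [hev1, hev2] with L hL3 hL2
    have hb := groundEnergy_gain_dWaveSourceTorus_zero_le (L := L + 1) hL3 μ s (η := t ^ 2) (by positivity)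
    refine hb.trans ?_
    set X : ℝ := ((L + 1 : ℕ) : ℝ) with hX
    have hX0 : 0 ≤ X := by positivity
    have hsq : Real.sqrt (t ^ 2) = t := Real.sqrt_sq ht0.le
    have habs : |s| = t ^ 4 := by rw [abs_of_pos hs0, ht4]
    have hs2 : Real.sqrt 2 * Real.sqrt 2 = 2 := Real.mul_self_sqrt zero_le_two
    have hΦh : Φ h = 8 * Real.sqrt 2 * t ^ 5 + 16 * t ^ 6 := by
      simp only [hΦ, hg]
      rw [← hs, ← ht, ← ht2, ← ht4]
      ring
    rw [hsq, habs, hΦh]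
    have hdiv : (4 * Real.sqrt 2 * t ^ 4) ^ 2 / (2 * t ^ 2) = 16 * t ^ 6 := by
      field_simp
      nlinarith [hs2]
    rw [hdiv]
    have key : 0 ≤ 4 * Real.sqrt 2 * t ^ 4 * X * (t * X - 2) := by
      have : 0 ≤ t * X - 2 := by linarith
      positivity
    nlinarith [key, Real.sqrt_nonneg 2]

end Final

end Literature.MathematicalPhysics.QuantumLattice

end
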